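/- LEAD seat `ym-line-cbag-p1` (prover-ym-line-cbag-p1-g28-0), LINE 7 `GlueballBandRecursion`, item ⟨stmt-QuantumFields-22957⟩
`OneParticleBlochSymbolFamily` (= `Band.EffectiveBlochSymbolFamily`): the COMPOSITION of the LEAD's one-XL-stub skeleton —
`IsolatedBandFrame → SymbolRegularityShell → UpperGapPropagation → EffectiveBlochSymbolFamily` — assembling the landed Bloch reduction
(`…BlochTransfer`), the concrete symbol (`…TransferSymbol`), the (P3) machinery (`…SymbolBandTop`) and the variational floor
(`…BandLevels`).  A door (conditional); route-dependent only through `…SymbolBandTop`'s import of `…BlochDoor`. -/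
import Summits.QuantumFields.YangMills.Theorems.GlueballBandRecursionIsolatedBandDefs
import Summits.QuantumFields.YangMills.Theorems.GlueballBandRecursionSymbolBandTop

/-!
# Route `GlueballBandRecursion`, item `OneParticleBlochSymbolFamily` (stmt-QuantumFields-22957): the effective Bloch symbol family from an
# isolated band frame

`effectiveBlochSymbolFamily_of_isolatedBandFrame : IsolatedBandFrame → SymbolRegularityShell → UpperGapPropagation →
Band.EffectiveBlochSymbolFamily`.  Given the three stub statements of `…IsolatedBandDefs`, the item's witnesses are, per `β` (non-escape
branch) and `N ≥ L₀`: `n` = the number of species of the frame, `Bt := kernelSymbol (transferKernel r β N ψ)` (Hermitian, periodic —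
`…TransferSymbol`), (P1)/(P2) = `SymbolRegularityShell` at the frame's kernel bounds (constant `K(θ, M)` uniform), (P3) = the attained supremum
(`exists_isMax_rayleigh_kernelSymbol`) with `|log Λ − ℓ| ≤ (D' + 12π²K)/N` from the frame's band-top stability and
`abs_log_sup_sub_log_bandTop_le` (power sums `Σ_p Re tr Bt(θ_p)^t = Σ_k (μ_k/λ₊)^t` by `kernelSymbol_transferKernel_latticeAngle` +
`transfer_bloch_reduction`), (P4) with `m₀ := s₀` the dilute anchor: lower half = `sum_pow_div_le_traceExcess` (constant 1 ≥ ½), upper half =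
`UpperGapPropagation` from the anchor (`x_{s₀+2} ≤ 2·band`) propagated to every `m ≥ s₀`, which covers the crux time `N/4 = m + 2` because
`s₀ + 2 ≤ N/4`.

HONEST FRAMING.  A conditional door: the XL stub `IsolatedBandFrame` (the periodic-torus, `N`-uniform one-glueball band — a cluster expansion
not in print) is NOT proved, nor are the two shells proved in THIS file; hence neither the item, nor the rung `ColdDoublingRecursionStrongCoupling`
(RECORD-type, strong coupling), nor a fortiori the Yang–Mills mass gap / the summit `YangMills` is proved or advanced here.
-/

set_option autoImplicit false

noncomputable section

open scoped InnerProductSpace BigOperators Matrix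
open Finset MeasureTheory
open Literature.MathematicalPhysics.QuantumFieldTheory
open Literature.MathematicalPhysics.QuantumFieldTheory.Balaban1983to89.Missing (strongCouplingRadius
  transferSpectralRadius_pos_of_unitary)

namespace Summit.QuantumFields.YangMills.Theorems.GlueballBandRecursion.Band

/-- **The effective one-particle Bloch symbol family from an isolated band frame** (the composition of the one-XL-stub skeleton of item
⟨stmt-QuantumFields-22957⟩; see the module docstring for the witnesses). -/
theorem effectiveBlochSymbolFamily_of_isolatedBandFrame (h1 : IsolatedBandFrame) (h3 : SymbolRegularityShell)
    (h4 : UpperGapPropagation) : EffectiveBlochSymbolFamily := by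
  intro G _ _ _ _
  letI : MeasurableSpace G := borel G
  haveI : BorelSpace G := ⟨rfl⟩
  intro r
  obtain ⟨n₀, θ, M, δ, D', hθ0, hθ1, hM0, hδ0, hδ1, hD'0, L₀, hβall⟩ := h1 G r
  obtain ⟨K, hK0, hK⟩ := h3 θ M hθ0 hθ1 hM0
  refine ⟨K, hK0, n₀, D' + 12 * Real.pi ^ 2 * K, by positivity, L₀, fun β hβ0 hβ => ?_⟩
  rcases hβall β hβ0 hβ with hesc | ⟨ℓ, hNall⟩
  · exact Or.inl hesc
  refine Or.inr ⟨ℓ, fun N _ hNL => ?_⟩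
  obtain ⟨n, hn0, hnn₀, ψ, e, μ, qmin, s, hψ, hcov, hinv, he, hμ, he_mem, hψ_mem, hqmin, hfloor, hlt, hiso, hs, hons, hoff,
    hon0, hmom2, ⟨kt, hkt, hstab⟩, ⟨s₀, hs₀N, hanchor⟩⟩ := hNall N hNL
  haveI : SecondCountableTopology G :=
    (r.continuous.isClosedEmbedding r.injective).isEmbedding.secondCountableTopology
  have hLpos : 0 < transferSpectralRadius r.ρ β N := transferSpectralRadius_pos_of_unitary r.ρ r.continuous r.mem_unitary hβ0 N
  have hN0 : (0 : ℝ) < N := by exact_mod_cast Nat.pos_of_ne_zero (NeZero.ne N)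
  -- the band ratios
  have hwq : ∀ k, qmin ≤ μ k / transferSpectralRadius r.ρ β N := fun k => (le_div_iff₀ hLpos).2 (hfloor k)
  have hw0 : ∀ k, 0 ≤ μ k / transferSpectralRadius r.ρ β N := fun k => hqmin.le.trans (hwq k)
  have hwkt : ∀ k, μ k / transferSpectralRadius r.ρ β N ≤ μ kt / transferSpectralRadius r.ρ β N :=
    fun k => div_le_div_of_nonneg_right (hkt k) hLpos.le
  have hwpos : 0 < μ kt / transferSpectralRadius r.ρ β N := hqmin.trans_le (hwq kt)
  -- the symbol `Bt := kernelSymbol (transferKernel r β N ψ)` and its lattice values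
  have hrefl : ∀ z, transferKernel r β N ψ (-z) = (transferKernel r β N ψ z)ᵀ := transferKernel_reflect r β N hcov
  have hP := hK N n (transferKernel r β N ψ) s hs hrefl hons hoff hon0 hmom2
  have hlat : ∀ p : Fin N × Fin N × Fin N,
      kernelSymbol (transferKernel r β N ψ) (latticeAngle N p) = transferBloch r β N ψ (cubeToSite p) :=
    kernelSymbol_transferKernel_latticeAngle r β N hcov
  have hsum : ∀ t : ℕ, ∑ p : Fin N × Fin N × Fin N,
      ((kernelSymbol (transferKernel r β N ψ) (latticeAngle N p) ^ t).trace).re =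
        ∑ k, (μ k / transferSpectralRadius r.ρ β N) ^ t := by
    intro t
    rw [transfer_bloch_reduction r β N hψ hcov hinv he hμ he_mem hψ_mem t,
      ← Fintype.sum_equiv cubeEquivSite
        (fun p => ((kernelSymbol (transferKernel r β N ψ) (latticeAngle N p) ^ t).trace).re)
        (fun q => ((transferBloch r β N ψ q ^ t).trace).re) (fun p => by rw [hlat]; rfl)]
  -- the attained supremum (P3)
  obtain ⟨qs, us, hus, hmax⟩ := exists_isMax_rayleigh_kernelSymbol hn0 (transferKernel r β N ψ)
  have hcmp := abs_log_sup_sub_log_bandTop_le (N := N) (kernelSymbol (transferKernel r β N ψ))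
    (kernelSymbol_isHermitian _) (kernelSymbol_periodic _) (fun k => μ k / transferSpectralRadius r.ρ β N) hw0 kt hwkt hwpos hsum
    (fun u hu => (hP u hu).1) hK0 (fun u hu => (hP u hu).2) hus rfl hmax
  refine ⟨n, hn0, hnn₀, kernelSymbol (transferKernel r β N ψ), kernelSymbol_isHermitian _, kernelSymbol_periodic _, hP,
    ⟨_, qs, us, hus, rfl, fun q u hu => hmax q u hu, ?_⟩, ⟨s₀, fun m hm => ?_⟩⟩
  · -- `|log Λ − ℓ| ≤ (D' + 12π²K)/N`
    have h1 : (12 * Real.pi ^ 2 * K) / (N : ℝ) ^ 2 ≤ (12 * Real.pi ^ 2 * K) / (N : ℝ) := by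
      have hN1 : (1 : ℝ) ≤ N := by exact_mod_cast Nat.pos_of_ne_zero (NeZero.ne N)
      refine div_le_div_of_nonneg_left (by positivity) hN0 ?_
      nlinarith
    rw [abs_le]
    rw [abs_le] at hstab
    constructor
    · have := hcmp.1
      rw [add_div]
      linarith [hstab.1]
    · rw [add_div]
      linarith [hcmp.2, hstab.2]
  · -- (P4) for `m ≥ s₀` (both cases)
    have hms : s₀ ≤ m := by
      rcases hm with hm | hm
      · exact hm
      · by_cases h8 : 8 ≤ N
        · have := hs₀N h8
          omega
        · exfalso
          have : N / 4 < 2 := by omega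
          omega
    set B : ℕ → ℝ := fun t => ∑ k, (μ k / transferSpectralRadius r.ρ β N) ^ t with hB
    have hBnn : ∀ t, 0 ≤ B t := fun t => Finset.sum_nonneg fun k _ => pow_nonneg (hw0 k) t
    have hlow : B (m + 2) ≤ traceExcess r.ρ β N (m + 2) := sum_pow_div_le_traceExcess r hβ0 N e he μ hμ hlt m
    -- upper: propagate the anchor
    have hprop := h4 G r β hβ0 hβ N n e μ qmin δ he hμ hqmin hδ0 hδ1 hfloor hlt hiso s₀ m hms
    have hgrow : (qmin) ^ (m - s₀) * B (s₀ + 2) ≤ B (m + 2) := by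
      rw [hB, Finset.mul_sum]
      refine Finset.sum_le_sum fun k _ => ?_
      have hk : (μ k / transferSpectralRadius r.ρ β N) ^ (m + 2) =
          (μ k / transferSpectralRadius r.ρ β N) ^ (m - s₀) * (μ k / transferSpectralRadius r.ρ β N) ^ (s₀ + 2) := by
        rw [← pow_add]
        congr 1
        omega
      rw [hk]
      exact mul_le_mul_of_nonneg_right (pow_le_pow_left₀ hqmin.le (hwq k) _) (pow_nonneg (hw0 k) _)
    have hδq : (δ * qmin) ^ (m - s₀) ≤ qmin ^ (m - s₀) := by
      rw [mul_pow]
      exact mul_le_of_le_one_left (pow_nonneg hqmin.le _) (pow_le_one₀ hδ0 hδ1.le)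
    have hup : traceExcess r.ρ β N (m + 2) ≤ 2 * B (m + 2) := by
      have h2 : traceExcess r.ρ β N (s₀ + 2) - B (s₀ + 2) ≤ B (s₀ + 2) := by
        have := hanchor
        rw [hB]
        linarith
      have h3 : (δ * qmin) ^ (m - s₀) * (traceExcess r.ρ β N (s₀ + 2) - B (s₀ + 2)) ≤ qmin ^ (m - s₀) * B (s₀ + 2) :=
        calc (δ * qmin) ^ (m - s₀) * (traceExcess r.ρ β N (s₀ + 2) - B (s₀ + 2))
            ≤ (δ * qmin) ^ (m - s₀) * B (s₀ + 2) :=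
              mul_le_mul_of_nonneg_left h2 (pow_nonneg (mul_nonneg hδ0 hqmin.le) _)
          _ ≤ qmin ^ (m - s₀) * B (s₀ + 2) := mul_le_mul_of_nonneg_right hδq (hBnn _)
      have h4' : traceExcess r.ρ β N (m + 2) - B (m + 2) ≤
          (δ * qmin) ^ (m - s₀) * (traceExcess r.ρ β N (s₀ + 2) - B (s₀ + 2)) := hprop
      linarith
    rw [hsum (m + 2)]
    constructor
    · linarith [hBnn (m + 2)]
    · exact hup

end Summit.QuantumFields.YangMills.Theorems.GlueballBandRecursion.Band

end
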